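import Literature.Computability.AlgebraicComplexity.StrongUSP
import HarnessLib

/-!
# The CKSU strong USP of size `2^k` and width `2k` (Cohn–Kleinberg–Szegedy–Umans 2005, Proposition 3.1 / 11)

Topic `Literature/Computability/AlgebraicComplexity` (group-theoretic matrix multiplication), companion of
`StrongUSP.lean`.  Cohn–Kleinberg–Szegedy–Umans 2005, §3, Proposition 3.1 (consecutive arXiv numbering:
Proposition 11), AS PRINTED: "For each `k ≥ 1`, there exists a strong USP of size `2^k` and width `2k`."
with the printed proof: "Viewing `{1,3}^k × {2,3}^k` as a subset of `{1,2,3}^{2k}`, we define `U` to be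
`{u ∈ {1,3}^k × {2,3}^k : for i ∈ [k], uᵢ = 1 iff u_{i+k} = 2}`. Suppose `π₁, π₂, π₃ ∈ Sym(U)`. If
`π₁ ≠ π₃`, then there exists `u ∈ U` such that `(π₁(u))ᵢ = 1` and `(π₃(u))ᵢ = 3` for some `i ∈ [k]`.
Similarly, if `π₂ ≠ π₃`, then there exists `u ∈ U` such that `(π₂(u))ᵢ = 2` and `(π₃(u))ᵢ = 3` for some
`i ∈ [2k] ∖ [k]`. In either case, exactly two of `(π₁(u))ᵢ = 1`, `(π₂(u))ᵢ = 2`, and `(π₃(u))ᵢ = 3` hold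
because in each coordinate only two of the three symbols `1`, `2`, and `3` can occur."

Formalisation: the rows are indexed by `Fin (2^k)` read as bit-vectors `Fin k → Fin 2`
(`finFunctionFinEquiv`), the `2k = k + k` columns by `Fin k ⊕ Fin k` (`finSumFinEquiv`); row `u` carries,
in the first half, `1` where the bit is set and `3` elsewhere, and in the second half `2` where the bit is
set and `3` elsewhere (`cksuStrongUSP k`, symbols coded `0,1,2` as in `StrongUSP.lean`).  The one step the
printed proof leaves implicit — why `π₁ ≠ π₃` forces a row `u` and a first-half column `i` with
`(π₁u)ᵢ = 1` and `(π₃u)ᵢ = 3` — is the counting argument `cksu_bit_witness`: for each column the sets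
`{u : (π₁u)ᵢ = 1}` and `{u : (π₃u)ᵢ = 1}` have the same size (both are images of `{u : uᵢ = 1}` under a
permutation), so if the first were contained in the second for every `i` they would coincide for every
`i`, i.e. `π₁u` and `π₃u` would have the same bits for every `u`, i.e. `π₁ = π₃`.  With
`omega_le_of_isStrongUSP` (census side, `OmegaCensus/StrongUSPOmegaBound.lean`: CKSU Cor. 3.6 as a
theorem) this family gives CKSU's "Proposition 3.1 yields `ω < 2.67` with `m = 9`" in the limit
`k → ∞`; that corollary is NOT in this file.

## References
* H. Cohn, R. Kleinberg, B. Szegedy, C. Umans, *Group-theoretic algorithms for matrix multiplication*,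
  FOCS 2005; arXiv:math/0511460, §3 (p. 5), Proposition 11 and its proof. [CohnKleinbergSzegedyUmans2005]
-/

namespace Literature.Computability.AlgebraicComplexity

open Equiv Finset

/-- The `i`-th bit of the row index `u ∈ Fin (2^k)` (row indices read as bit-vectors `Fin k → Fin 2` via
`finFunctionFinEquiv`). [cite: CohnKleinbergSzegedyUmans2005, Proposition 11 (§3), proof] -/
def cksuBit {k : ℕ} (u : Fin (2 ^ k)) (i : Fin k) : Bool :=
  decide (finFunctionFinEquiv.symm u i = 1)

/-- **The CKSU strong USP of size `2^k` and width `2k`** (Prop. 3.1 / 11, proof): the row with bit-vector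
`b ∈ {0,1}^k` is `(x₁ … x_k | y₁ … y_k)` with `xᵢ = 1`, `yᵢ = 2` if `bᵢ = 1` and `xᵢ = yᵢ = 3` otherwise —
i.e. `U = {u ∈ {1,3}^k × {2,3}^k : uᵢ = 1 iff u_{i+k} = 2}` (symbols `1,2,3` coded `0,1,2`).
[cite: CohnKleinbergSzegedyUmans2005, Proposition 11 (§3, p. 5)] -/
def cksuStrongUSP (k : ℕ) : Fin (2 ^ k) → Fin (k + k) → Fin 3 :=
  fun u j => match finSumFinEquiv.symm j with
    | Sum.inl i => if cksuBit u i then 0 else 2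
    | Sum.inr i => if cksuBit u i then 1 else 2

/-- First-half entries: `1` on set bits, `3` otherwise. [cite: CohnKleinbergSzegedyUmans2005, Proposition 11 (§3), proof] -/
private theorem cksuStrongUSP_inl {k : ℕ} (u : Fin (2 ^ k)) (i : Fin k) :
    cksuStrongUSP k u (finSumFinEquiv (Sum.inl i)) = if cksuBit u i then 0 else 2 := by
  unfold cksuStrongUSP; rw [Equiv.symm_apply_apply]

/-- Second-half entries: `2` on set bits, `3` otherwise. [cite: CohnKleinbergSzegedyUmans2005, Proposition 11 (§3), proof] -/
private theorem cksuStrongUSP_inr {k : ℕ} (u : Fin (2 ^ k)) (i : Fin k) :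
    cksuStrongUSP k u (finSumFinEquiv (Sum.inr i)) = if cksuBit u i then 1 else 2 := by
  unfold cksuStrongUSP; rw [Equiv.symm_apply_apply]

/-- Rows are determined by their bits. [folklore] -/
private theorem cksuBit_injective (k : ℕ) : Function.Injective (fun u : Fin (2 ^ k) => cksuBit u) := by
  intro u v huv
  apply finFunctionFinEquiv.symm.injective
  funext i
  have h := congrFun huv i
  simp only [cksuBit, decide_eq_decide] at h
  -- both values lie in `Fin 2 = {0, 1}`
  rcases Fin.exists_fin_two.mp ⟨finFunctionFinEquiv.symm u i, rfl⟩ with hu | hu <;>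
    rcases Fin.exists_fin_two.mp ⟨finFunctionFinEquiv.symm v i, rfl⟩ with hv | hv <;>
    simp_all

/-- The counting step left implicit in the printed proof: for two DISTINCT permutations `σ ≠ τ` of the rows
there are a row `u` and a bit position `i` with the bit of `σ u` set and the bit of `τ u` clear.  (For each
`i`, `{u : bit (σ u) i}` and `{u : bit (τ u) i}` are equinumerous with `{u : bit u i}`; containment for every
`i` would give equality for every `i`, hence `σ u = τ u` for every `u`.)
[cite: CohnKleinbergSzegedyUmans2005, Proposition 11 (§3), proof] -/
theorem cksu_bit_witness {k : ℕ} {σ τ : Perm (Fin (2 ^ k))} (h : σ ≠ τ) :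
    ∃ u : Fin (2 ^ k), ∃ i : Fin k, cksuBit (σ u) i = true ∧ cksuBit (τ u) i = false := by
  classical
  by_contra hno
  simp only [not_exists, not_and, Bool.not_eq_false] at hno
  -- hno : ∀ u i, bit (σ u) i = true → bit (τ u) i = true
  apply h
  -- equal cardinalities of the filters
  have hcard : ∀ (ρ : Perm (Fin (2 ^ k))) (i : Fin k),
      (univ.filter fun u => cksuBit (ρ u) i = true).card = (univ.filter fun u => cksuBit u i = true).card := by
    intro ρ i
    have hmap : (univ.filter fun u => cksuBit (ρ u) i = true).map ρ.toEmbedding =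
        univ.filter fun u => cksuBit u i = true := by
      ext x
      simp only [Finset.mem_map, Finset.mem_filter, Finset.mem_univ, true_and, Equiv.toEmbedding_apply]
      constructor
      · rintro ⟨u, hu, rfl⟩; exact hu
      · intro hx; exact ⟨ρ.symm x, by simpa using hx, by simp⟩
    rw [← hmap, Finset.card_map]
  have hsets : ∀ i : Fin k,
      (univ.filter fun u => cksuBit (σ u) i = true) = univ.filter fun u => cksuBit (τ u) i = true := by
    intro i
    apply Finset.eq_of_subset_of_card_le
    · intro u hu
      simp only [Finset.mem_filter, Finset.mem_univ, true_and] at hu ⊢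
      exact hno u i hu
    · rw [hcard σ i, hcard τ i]
  ext u : 1
  -- bits of `σ u` and `τ u` agree
  have hbits : cksuBit (σ u) = cksuBit (τ u) := by
    funext i
    have hi := congrArg (fun s : Finset (Fin (2 ^ k)) => u ∈ s) (hsets i)
    simp only [Finset.mem_filter, Finset.mem_univ, true_and, eq_iff_iff] at hi
    rcases Bool.eq_false_or_eq_true (cksuBit (σ u) i) with h1 | h1 <;>
      rcases Bool.eq_false_or_eq_true (cksuBit (τ u) i) with h2 | h2 <;> simp_all
  exact cksuBit_injective k hbits

/-- **Cohn–Kleinberg–Szegedy–Umans 2005, Proposition 3.1 / 11**: `cksuStrongUSP k` (size `2^k`, width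
`2k`) is a strong USP, for every `k` — proved as printed (with the counting step `cksu_bit_witness`): if
`π₁ ≠ π₃` a first-half column separates them with the pattern `(1, ·, 3)` (the middle entry is `1` or `3`,
never `2`), and if `π₂ ≠ π₃` a second-half column gives `(·, 2, 3)` (first entry `2` or `3`, never `1`).
[cite: CohnKleinbergSzegedyUmans2005, Proposition 11 (§3, p. 5)] -/
theorem isStrongUSP_cksuStrongUSP (k : ℕ) : IsStrongUSP (cksuStrongUSP k) := by
  intro π₁ π₂ π₃
  by_cases h13 : π₁ = π₃
  · by_cases h23 : π₂ = π₃
    · exact Or.inl ⟨h13.trans h23.symm, h23⟩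
    · -- second half separates π₂ from π₃
      obtain ⟨u, i, h2, h3⟩ := cksu_bit_witness h23
      refine Or.inr ⟨u, finSumFinEquiv (Sum.inr i), ?_⟩
      rw [cksuStrongUSP_inr, cksuStrongUSP_inr, cksuStrongUSP_inr, h2, h3]
      right; right
      refine ⟨?_, by simp, by simp⟩
      cases cksuBit (π₁ u) i <;> decide
  · -- first half separates π₁ from π₃
    obtain ⟨u, i, h1, h3⟩ := cksu_bit_witness h13
    refine Or.inr ⟨u, finSumFinEquiv (Sum.inl i), ?_⟩
    rw [cksuStrongUSP_inl, cksuStrongUSP_inl, cksuStrongUSP_inl, h1, h3]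
    right; left
    refine ⟨by simp, ?_, by simp⟩
    cases cksuBit (π₂ u) i <;> decide

/-- **Cohn–Kleinberg–Szegedy–Umans 2005, Proposition 3.1 / 11, AS PRINTED**: "For each `k ≥ 1`, there exists
a strong USP of size `2^k` and width `2k`" (here for every `k`, the case `k = 0` being the one-row puzzle).
[cite: CohnKleinbergSzegedyUmans2005, Proposition 11 (§3, p. 5)] -/
theorem CohnKleinbergSzegedyUmans2005_prop11 (k : ℕ) :
    ∃ row : Fin (2 ^ k) → Fin (2 * k) → Fin 3, IsStrongUSP row := by
  rw [two_mul]
  exact ⟨cksuStrongUSP k, isStrongUSP_cksuStrongUSP k⟩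

end Literature.Computability.AlgebraicComplexity
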